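import Summits.QuantumFields.YangMills.Theorems.EquipartitionCriticalityFreeEnergyLogCoefficientExpChartMeasure
import Summits.QuantumFields.YangMills.Theorems.BalabanLadderNTLinkEquipartitionDefs
import HarnessLib

/-!
# Crux `NT` (stmt-QuantumFields-19353): the one-link EQUIPARTITION FLOOR (hypothesis-free)

Fleet lead prover of crux `NT` (unit `ym-spine-19353-p1`, g9).  For a compact group `G` presented by a faithful continuous
unitary representation `ρ : G →* M_N(ℂ)` whose Lie algebra has positive dimension `D = dimE ρ`, and for every finite
non-empty family of "staples" `k : ι → G`, the one-link Wilson cost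

  `u_k(h) = Σ_i (N − Re tr ρ(h k_i)) = ½ Σ_i ‖ρ h − ρ(k_i⁻¹)‖_F²`

has, under its own Gibbs tilt `e^{−β u_k} dσ` of the Haar probability measure `σ`, mean AT LEAST `θ/(2β)` for all `β ≥ β₀`,
with `θ, β₀ > 0` depending on `(G, ρ)` only — NOT on `β`, not on the family `k`, not on its size (`linkCost_floor`):

  `(θ/(2β)) ∫ e^{−β u_k} dσ ≤ ∫ u_k e^{−β u_k} dσ`.

This is the anti-concentration ("the link does not freeze faster than `1/β`") half of equipartition; it is what turns
into the volume-uniform ONE-POINT FLOOR `c/β ≤ 6N − E_{T,β}[A_x]` of the crux's action density and into the floor twin of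
g8's zero-momentum sum-rule ceilings (sequel files).  Mechanism (no integration by parts, no chart beyond the tree's;
the Frobenius bookkeeping and the two-sided PINCH `(m/4) r² − u₀ ≤ u_k(h) ≤ m r² + 2u₀` of `u_k` around a minimiser `g₀`,
`r = ‖ρ h − ρ g₀‖_F`, `u₀ = u_k(g₀)`, `m = #ι`, are in `Theorems/BalabanLadderNTLinkEquipartitionDefs`):

* §1 the tree's soft Haar constant (`FreeEnergyLogCoefficient.haarConstE_spec`, Chatterjee Thm. 11.1 analogue) as
  TWO-SIDED small-ball bounds `c₁ δ^D ≤ σ{‖ρ g − 1‖ ≤ δ} ≤ c₂ δ^D` (`0 < δ ≤ δ₀`);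
* §2 the floor: if `u₀ > θ/β` the mean is `≥ u₀`; else the Gibbs weight of the ball `r ≤ (βm)^{-1/2}` is `≥ e^{−3} c₁ (βm)^{−D/2}`
  while `{u_k < θ/β}` lies in the ball `r ≤ √(8θ)·(βm)^{-1/2}` of Haar measure `≤ c₂ √(8θ) (βm)^{−D/2}` (`D ≥ 1`), so for
  `√(8θ) ≤ c₁/(2e³c₂)` the tilted law puts mass `≥ 1/2` on `{u_k ≥ θ/β}`.

HONEST FRAMING.  Folklore equipartition at the Gaussian scale, in the tree's letters and uniform in the staples; the sharp
constant (`β E[s₀] → 3D/2`, Chatterjee / the tree's `EquipartitionPinsProbe.stub_equipartition` for torus-LIMIT states) is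
not claimed.  Nothing here is a two-point floor, NT, the seam or the gap; not Clay.
Refs: Montvay–Münster 1994 §3.2 (weak-coupling expansion of the plaquette); Chatterjee, arXiv:1602.01222, Thm. 2.1/11.1.
-/

set_option autoImplicit false

noncomputable section

open scoped Matrix Matrix.Norms.Frobenius ENNReal NNReal Topology BigOperators
open MeasureTheory Measure Filter Set Metric
open Literature.MathematicalPhysics.QuantumLattice Literature.MathematicalPhysics.QuantumFieldTheory
open Summit.QuantumFields.YangMills.Theorems.FreeEnergyLogCoefficient

namespace Summit.QuantumFields.YangMills.Cruxes.NT.LinkEquipartition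

/-! ## §1 Two-sided small-ball bounds for the Haar measure of a compact matrix group -/

section SmallBall

variable {N : ℕ} {G : Type*} [Group G] [TopologicalSpace G] [IsTopologicalGroup G] [CompactSpace G]
  [MeasurableSpace G] [BorelSpace G] (ρ : G →* Matrix (Fin N) (Fin N) ℂ)

/-- **Two-sided small-ball bounds** from the tree's soft Haar constant (`haarConstE_spec`): there are `δ₀, c₁, c₂ > 0`
with `c₁ δ^D ≤ σ{g : ‖ρ g − 1‖_F ≤ δ} ≤ c₂ δ^D` for all `0 < δ ≤ δ₀`, `D = dimE ρ`, `σ` the Haar probability measure.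
[cite: arXiv160201222, Thm. 11.1 (analogue)] -/
theorem exists_haar_gball_two_sided (hρ : Continuous ρ) (hinj : Function.Injective ρ)
    (hU : ∀ g, ρ g ∈ Matrix.unitaryGroup (Fin N) ℂ) :
    ∃ δ₀ c₁ c₂ : ℝ, 0 < δ₀ ∧ 0 < c₁ ∧ 0 < c₂ ∧ ∀ δ : ℝ, 0 < δ → δ ≤ δ₀ →
      c₁ * δ ^ dimE ρ ≤ (haarProbability G).real {g : G | ‖ρ g - 1‖ ≤ δ} ∧
      (haarProbability G).real {g : G | ‖ρ g - 1‖ ≤ δ} ≤ c₂ * δ ^ dimE ρ := by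
  obtain ⟨hc0, hctop, hT⟩ := haarConstE_spec ρ hρ hinj hU
  set c := haarConstE ρ with hc
  set v₁ : ℝ≥0∞ := volume (closedBall (0 : EuclideanSpace ℝ (Fin (dimE ρ))) 1) with hv₁
  have hv₁0 : v₁ ≠ 0 := (volume_closedBall_fin_pos (0 : EuclideanSpace ℝ (Fin (dimE ρ))) one_pos).ne'
  have hv₁top : v₁ ≠ ∞ := (measure_closedBall_lt_top).ne
  -- eventually the ratio is in `(c/2, c+1)`
  have hlo : ∀ᶠ δ in 𝓝[>] (0 : ℝ), c / 2 < ballRatioE ρ δ :=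
    hT.eventually (isOpen_Ioi.mem_nhds (ENNReal.half_lt_self hc0 hctop))
  have hhi : ∀ᶠ δ in 𝓝[>] (0 : ℝ), ballRatioE ρ δ < c + 1 :=
    hT.eventually (isOpen_Iio.mem_nhds (ENNReal.lt_add_right hctop one_ne_zero))
  obtain ⟨δ', hδ'pos, hsub⟩ := mem_nhdsGT_iff_exists_Ioo_subset.1 (hlo.and hhi)
  refine ⟨δ' / 2, (c / 2 * v₁).toReal, ((c + 1) * v₁).toReal, by positivity [mem_Ioi.1 hδ'pos], ?_, ?_,
    fun δ hδ hδle => ?_⟩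
  · exact ENNReal.toReal_pos (mul_ne_zero (ENNReal.div_ne_zero.2 ⟨hc0, ENNReal.ofNat_ne_top⟩) hv₁0)
      (ENNReal.mul_ne_top (ENNReal.div_ne_top hctop two_ne_zero) hv₁top)
  · exact ENNReal.toReal_pos (mul_ne_zero (by simp [hc0]) hv₁0) (ENNReal.mul_ne_top (by simp [hctop]) hv₁top)
  have hδ' : δ ∈ Ioo 0 δ' := ⟨hδ, by linarith [mem_Ioi.1 hδ'pos]⟩
  obtain ⟨h1, h2⟩ := hsub hδ'
  have hvol : volume (closedBall (0 : EuclideanSpace ℝ (Fin (dimE ρ))) δ) = ENNReal.ofReal (δ ^ dimE ρ) * v₁ :=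
    volume_closedBall_fin 0 hδ.le
  have hvδ0 : volume (closedBall (0 : EuclideanSpace ℝ (Fin (dimE ρ))) δ) ≠ 0 :=
    (volume_closedBall_fin_pos (0 : EuclideanSpace ℝ (Fin (dimE ρ))) hδ).ne'
  have hvδtop : volume (closedBall (0 : EuclideanSpace ℝ (Fin (dimE ρ))) δ) ≠ ∞ := (measure_closedBall_lt_top).ne
  have hσ : haarProbability G {g : G | ‖ρ g - 1‖ ≤ δ} =
      ballRatioE ρ δ * volume (closedBall (0 : EuclideanSpace ℝ (Fin (dimE ρ))) δ) := by
    rw [ballRatioE, ENNReal.div_mul_cancel hvδ0 hvδtop]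
  have hpow : 0 ≤ δ ^ dimE ρ := pow_nonneg hδ.le _
  constructor
  · -- lower bound
    have hle : c / 2 * volume (closedBall (0 : EuclideanSpace ℝ (Fin (dimE ρ))) δ) ≤
        haarProbability G {g : G | ‖ρ g - 1‖ ≤ δ} := by
      rw [hσ]; gcongr
    rw [hvol] at hle
    have := ENNReal.toReal_mono (measure_ne_top _ _) hle
    rw [measureReal_def]
    calc (c / 2 * v₁).toReal * δ ^ dimE ρ = (c / 2 * (ENNReal.ofReal (δ ^ dimE ρ) * v₁)).toReal := by
          rw [ENNReal.toReal_mul, ENNReal.toReal_mul, ENNReal.toReal_mul, ENNReal.toReal_ofReal hpow]; ring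
      _ ≤ _ := this
  · -- upper bound
    have hle : haarProbability G {g : G | ‖ρ g - 1‖ ≤ δ} ≤
        (c + 1) * volume (closedBall (0 : EuclideanSpace ℝ (Fin (dimE ρ))) δ) := by
      rw [hσ]; gcongr
    rw [hvol] at hle
    have hne : (c + 1) * (ENNReal.ofReal (δ ^ dimE ρ) * v₁) ≠ ∞ :=
      ENNReal.mul_ne_top (by simp [hctop]) (ENNReal.mul_ne_top ENNReal.ofReal_ne_top hv₁top)
    have := ENNReal.toReal_mono hne hle
    rw [measureReal_def]
    calc _ ≤ ((c + 1) * (ENNReal.ofReal (δ ^ dimE ρ) * v₁)).toReal := this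
      _ = ((c + 1) * v₁).toReal * δ ^ dimE ρ := by
          rw [ENNReal.toReal_mul, ENNReal.toReal_mul, ENNReal.toReal_mul, ENNReal.toReal_ofReal hpow]; ring

end SmallBall

/-! ## §2 The equipartition floor -/

section Floor

variable {N : ℕ} {G : Type*} [Group G] [TopologicalSpace G] [IsTopologicalGroup G] [CompactSpace G]
  [MeasurableSpace G] [BorelSpace G] (ρ : G →* Matrix (Fin N) (Fin N) ℂ)

omit [Group G] [IsTopologicalGroup G] [CompactSpace G] in
/-- A bounded continuous real function is integrable for a finite measure on `G`. [folklore] -/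
theorem integrable_of_continuous_of_abs_le {μ : Measure G} [IsFiniteMeasure μ] {f : G → ℝ} (hf : Continuous f)
    {C : ℝ} (hC : ∀ x, |f x| ≤ C) : Integrable f μ :=
  Integrable.mono' (integrable_const C) hf.measurable.aestronglyMeasurable
    (ae_of_all _ fun x => by simpa [Real.norm_eq_abs] using hC x)

/-- **THE ONE-LINK EQUIPARTITION FLOOR.**  For a compact group with a faithful continuous unitary representation `ρ` of
positive Lie dimension there are `θ, β₀ > 0` (depending on `(G, ρ)` only) such that for every `β ≥ β₀`, every finite non-empty
family of staples `k : ι → G`: `(θ/(2β)) ∫ e^{−β u_k} dσ ≤ ∫ u_k e^{−β u_k} dσ` (`σ` = Haar probability) — the Gibbs-tilted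
mean of the one-link cost is at least `θ/(2β)`, uniformly in the staples and in their number. [folklore] -/
theorem linkCost_floor (hρ : Continuous ρ) (hinj : Function.Injective ρ)
    (hU : ∀ g, ρ g ∈ Matrix.unitaryGroup (Fin N) ℂ) (hD : 0 < dimE ρ) :
    ∃ θ β₀ : ℝ, 0 < θ ∧ 0 < β₀ ∧ ∀ β : ℝ, β₀ ≤ β →
      ∀ (ι : Type) [Fintype ι] [Nonempty ι] (k : ι → G),
        θ / (2 * β) * ∫ h, Real.exp (-β * linkCost ρ k h) ∂(haarProbability G) ≤
          ∫ h, linkCost ρ k h * Real.exp (-β * linkCost ρ k h) ∂(haarProbability G) := by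
  obtain ⟨δ₀, c₁, c₂, hδ₀, hc₁, hc₂, hball⟩ := exists_haar_gball_two_sided ρ hρ hinj hU
  -- constants
  set s₀ : ℝ := min 1 (c₁ / (2 * Real.exp 3 * c₂)) with hs₀
  have hs₀pos : 0 < s₀ := lt_min one_pos (by positivity)
  have hs₀1 : s₀ ≤ 1 := min_le_left _ _
  have hs₀c : s₀ ≤ c₁ / (2 * Real.exp 3 * c₂) := min_le_right _ _
  set θ : ℝ := s₀ ^ 2 / 8 with hθ
  have hθpos : 0 < θ := by positivity
  have hθ1 : θ ≤ 1 := by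
    have : s₀ ^ 2 ≤ 1 := by nlinarith
    rw [hθ]; linarith
  refine ⟨θ, 1 / δ₀ ^ 2, hθpos, by positivity, fun β hβ ι _ _ k => ?_⟩
  have hβ0 : 0 < β := lt_of_lt_of_le (by positivity) hβ
  set σ := haarProbability G with hσ
  set m : ℝ := (Fintype.card ι : ℝ) with hm
  have hm1 : 1 ≤ m := by rw [hm]; exact_mod_cast Fintype.card_pos
  set u := linkCost ρ k with hu
  have hu0 : ∀ h, 0 ≤ u h := linkCost_nonneg ρ hU k
  have hucont : Continuous u := continuous_linkCost ρ hρ k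
  obtain ⟨g₀, hg₀⟩ := exists_linkCost_le_linkCost ρ hρ k
  set u₀ := u g₀ with hu₀
  -- the Gibbs weight and its integrability
  set w : G → ℝ := fun h => Real.exp (-β * u h) with hw
  have hwpos : ∀ h, 0 < w h := fun h => Real.exp_pos _
  have hw1 : ∀ h, w h ≤ 1 := fun h => by
    rw [hw]; exact Real.exp_le_one_iff.2 (by nlinarith [hu0 h])
  have hwcont : Continuous w := Real.continuous_exp.comp (continuous_const.mul hucont)
  have hwint : Integrable w σ := integrable_of_continuous_of_abs_le hwcont (C := 1) fun h => by
    rw [abs_of_pos (hwpos h)]; exact hw1 h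
  -- `u · w` is bounded by `1/β`… we only need SOME bound: `u w ≤ u e^{-βu} ≤ 1/β`, use `|u w| ≤ B` with `B` a bound of `u`
  obtain ⟨B, hB⟩ : ∃ B, ∀ h, |u h| ≤ B := by
    obtain ⟨B, hB⟩ := (isCompact_univ.image hucont).isBounded.exists_norm_le
    exact ⟨B, fun h => hB _ ⟨h, Set.mem_univ _, rfl⟩⟩
  have huwint : Integrable (fun h => u h * w h) σ :=
    integrable_of_continuous_of_abs_le (hucont.mul hwcont) (C := B) fun h => by
      rw [abs_mul, abs_of_pos (hwpos h)]
      exact (mul_le_of_le_one_right (abs_nonneg _) (hw1 h)).trans (hB h)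
  set Z := ∫ h, w h ∂σ with hZ
  show θ / (2 * β) * Z ≤ ∫ h, u h * w h ∂σ
  by_cases hcase : θ / β < u₀
  · -- frustrated regime: `u ≥ u₀ > θ/β` everywhere
    calc θ / (2 * β) * Z = ∫ h, θ / (2 * β) * w h ∂σ := (integral_const_mul _ _).symm
      _ ≤ ∫ h, u h * w h ∂σ := by
          refine integral_mono (hwint.const_mul _) huwint fun h => ?_
          have h1 : θ / (2 * β) ≤ θ / β := div_le_div_of_nonneg_left hθpos.le hβ0 (by linarith)
          exact mul_le_mul_of_nonneg_right (h1.trans (hcase.le.trans (hg₀ h))) (hwpos h).le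
  · replace hcase : u₀ ≤ θ / β := not_lt.1 hcase
    -- the two radii
    set δ₁ : ℝ := 1 / Real.sqrt (β * m) with hδ₁
    have hβm : 0 < β * m := by positivity
    have hδ₁pos : 0 < δ₁ := by positivity
    have hδ₁sq : δ₁ ^ 2 = 1 / (β * m) := by
      rw [hδ₁, div_pow, one_pow, Real.sq_sqrt hβm.le]
    have hδ₁le : δ₁ ≤ δ₀ := by
      have h1 : δ₁ ^ 2 ≤ δ₀ ^ 2 := by
        rw [hδ₁sq, div_le_iff₀ hβm]
        have e : 1 / δ₀ ^ 2 * δ₀ ^ 2 = 1 := by field_simp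
        calc (1 : ℝ) = 1 / δ₀ ^ 2 * δ₀ ^ 2 := e.symm
          _ ≤ β * δ₀ ^ 2 := mul_le_mul_of_nonneg_right hβ (sq_nonneg δ₀)
          _ = δ₀ ^ 2 * β * 1 := by ring
          _ ≤ δ₀ ^ 2 * β * m := mul_le_mul_of_nonneg_left hm1 (by positivity)
          _ = δ₀ ^ 2 * (β * m) := by ring
      exact (pow_le_pow_iff_left₀ hδ₁pos.le hδ₀.le two_ne_zero).1 h1
    set δ₂ : ℝ := s₀ * δ₁ with hδ₂
    have hδ₂pos : 0 < δ₂ := mul_pos hs₀pos hδ₁pos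
    have hδ₂le : δ₂ ≤ δ₁ := by rw [hδ₂]; exact mul_le_of_le_one_left hδ₁pos.le hs₀1
    have hδ₂sq : δ₂ ^ 2 = 8 * θ / (β * m) := by
      rw [hδ₂, mul_pow, hδ₁sq, hθ]; ring
    -- (1) lower bound on `Z` from the ball of radius `δ₁` around `g₀`
    set B₁ : Set G := {h | ‖ρ h - ρ g₀‖ ≤ δ₁} with hB₁
    have hB₁m : MeasurableSet B₁ :=
      (isClosed_le (continuous_norm.comp (hρ.sub continuous_const)) continuous_const).measurableSet
    have hσB₁ : c₁ * δ₁ ^ dimE ρ ≤ σ.real B₁ := by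
      have := (hball δ₁ hδ₁pos hδ₁le).1
      rwa [measureReal_def, ← haar_setOf_norm_sub_le ρ hU g₀ δ₁, ← measureReal_def] at this
    have hZlow : Real.exp (-3) * (c₁ * δ₁ ^ dimE ρ) ≤ Z := by
      have hpt : ∀ h, Real.exp (-3) * B₁.indicator (fun _ => (1 : ℝ)) h ≤ w h := by
        intro h
        by_cases hh : h ∈ B₁
        · rw [Set.indicator_of_mem hh, mul_one, hw]
          refine Real.exp_le_exp.2 ?_
          have hp := (linkCost_pinch ρ hU k g₀ h).2
          have hr : ‖ρ h - ρ g₀‖ ^ 2 ≤ δ₁ ^ 2 := pow_le_pow_left₀ (norm_nonneg _) hh 2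
          have h1 : β * (m * ‖ρ h - ρ g₀‖ ^ 2) ≤ 1 := by
            calc β * (m * ‖ρ h - ρ g₀‖ ^ 2) ≤ β * (m * δ₁ ^ 2) := by gcongr
              _ = 1 := by rw [hδ₁sq]; field_simp
          have h2 : β * u₀ ≤ θ := by rwa [le_div_iff₀ hβ0, mul_comm] at hcase
          have h3 : u h ≤ m * ‖ρ h - ρ g₀‖ ^ 2 + 2 * u₀ := hp
          nlinarith [hu0 h]
        · rw [Set.indicator_of_notMem hh, mul_zero]; exact (hwpos h).le
      calc Real.exp (-3) * (c₁ * δ₁ ^ dimE ρ) ≤ Real.exp (-3) * σ.real B₁ :=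
            mul_le_mul_of_nonneg_left hσB₁ (Real.exp_pos _).le
        _ = ∫ h, Real.exp (-3) * B₁.indicator (fun _ => (1 : ℝ)) h ∂σ := by
            rw [integral_const_mul, integral_indicator hB₁m, setIntegral_const, smul_eq_mul, mul_one]
        _ ≤ Z := integral_mono ((integrable_const (1 : ℝ)).indicator hB₁m |>.const_mul _) hwint hpt
    -- (2) the bad set `{u < θ/β}` lies in the ball of radius `δ₂`
    set S : Set G := {h | u h < θ / β} with hS
    have hSm : MeasurableSet S := (isOpen_lt hucont continuous_const).measurableSet
    have hSB : S ⊆ {h | ‖ρ h - ρ g₀‖ ≤ δ₂} := by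
      intro h hh
      have hp := (linkCost_pinch ρ hU k g₀ h).1
      have hlt : u h < θ / β := hh
      have hr2 : ‖ρ h - ρ g₀‖ ^ 2 < δ₂ ^ 2 := by
        rw [hδ₂sq, lt_div_iff₀ hβm]
        have h1 : m / 4 * ‖ρ h - ρ g₀‖ ^ 2 < θ / β + u₀ := by linarith
        have h2 : θ / β + u₀ ≤ 2 * (θ / β) := by linarith
        have h3 : m / 4 * ‖ρ h - ρ g₀‖ ^ 2 * β < 2 * θ := by
          calc m / 4 * ‖ρ h - ρ g₀‖ ^ 2 * β < 2 * (θ / β) * β := mul_lt_mul_of_pos_right (h1.trans_le h2) hβ0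
            _ = 2 * θ := by field_simp
        nlinarith
      exact le_of_lt ((pow_lt_pow_iff_left₀ (norm_nonneg _) hδ₂pos.le two_ne_zero).1 hr2)
    have hσS : σ.real S ≤ c₂ * s₀ * δ₁ ^ dimE ρ := by
      calc σ.real S ≤ σ.real {h | ‖ρ h - ρ g₀‖ ≤ δ₂} := measureReal_mono hSB
        _ = σ.real {h | ‖ρ h - 1‖ ≤ δ₂} := by rw [measureReal_def, haar_setOf_norm_sub_le ρ hU g₀ δ₂, measureReal_def]
        _ ≤ c₂ * δ₂ ^ dimE ρ := (hball δ₂ hδ₂pos (hδ₂le.trans hδ₁le)).2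
        _ = c₂ * (s₀ ^ dimE ρ * δ₁ ^ dimE ρ) := by rw [hδ₂, mul_pow]
        _ ≤ c₂ * (s₀ * δ₁ ^ dimE ρ) := by
            have hD1 : 1 ≤ dimE ρ := Nat.succ_le_of_lt hD
            have hsD : s₀ ^ dimE ρ ≤ s₀ := (pow_le_pow_of_le_one hs₀pos.le hs₀1 hD1).trans_eq (pow_one _)
            have hδD : 0 ≤ δ₁ ^ dimE ρ := pow_nonneg hδ₁pos.le _
            exact mul_le_mul_of_nonneg_left (mul_le_mul_of_nonneg_right hsD hδD) hc₂.le
        _ = c₂ * s₀ * δ₁ ^ dimE ρ := by ring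
    -- (3) the bad set carries at most half of the Gibbs weight
    have hbad : ∫ h in S, w h ∂σ ≤ Z / 2 := by
      have h1 : ∫ h in S, w h ∂σ ≤ σ.real S := by
        calc ∫ h in S, w h ∂σ ≤ ∫ h in S, (1 : ℝ) ∂σ :=
              setIntegral_mono hwint.integrableOn (integrableOn_const (measure_ne_top _ _)) hw1
          _ = σ.real S := by rw [setIntegral_const, smul_eq_mul, mul_one]
      have h2 : c₂ * s₀ ≤ c₁ / (2 * Real.exp 3) := by
        have := mul_le_mul_of_nonneg_left hs₀c hc₂.le
        calc c₂ * s₀ ≤ c₂ * (c₁ / (2 * Real.exp 3 * c₂)) := this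
          _ = c₁ / (2 * Real.exp 3) := by field_simp
      have h3 : σ.real S ≤ c₁ / (2 * Real.exp 3) * δ₁ ^ dimE ρ :=
        hσS.trans (mul_le_mul_of_nonneg_right h2 (pow_nonneg hδ₁pos.le _))
      have h4 : c₁ / (2 * Real.exp 3) * δ₁ ^ dimE ρ = Real.exp (-3) * (c₁ * δ₁ ^ dimE ρ) / 2 := by
        rw [Real.exp_neg]; field_simp
      linarith
    -- conclusion
    have hpt : ∀ h, θ / β * (w h - S.indicator w h) ≤ u h * w h := by
      intro h
      by_cases hh : h ∈ S
      · rw [Set.indicator_of_mem hh, sub_self, mul_zero]; exact mul_nonneg (hu0 h) (hwpos h).le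
      · rw [Set.indicator_of_notMem hh, sub_zero]
        have : θ / β ≤ u h := not_lt.1 hh
        exact mul_le_mul_of_nonneg_right this (hwpos h).le
    have hint := integral_mono ((hwint.sub (hwint.indicator hSm)).const_mul (θ / β)) huwint hpt
    rw [integral_const_mul, integral_sub' hwint (hwint.indicator hSm), integral_indicator hSm] at hint
    have hθβ : 0 ≤ θ / β := by positivity
    calc θ / (2 * β) * Z = θ / β * (Z - Z / 2) := by field_simp; ring
      _ ≤ θ / β * (Z - ∫ h in S, w h ∂σ) := by gcongr
      _ ≤ ∫ h, u h * w h ∂σ := hint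

end Floor

end Summit.QuantumFields.YangMills.Cruxes.NT.LinkEquipartition

end
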